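import Summits.HubbardSuperconductivity.HubbardSuperconductivity.Theorems.FunctionFieldCertificateMesoscopicPairOrderBoxOrderRefutationLemmas
import Summits.HubbardSuperconductivity.HubbardSuperconductivity.Theorems.FunctionFieldCertificateMesoscopicPairOrderBoxTransferCore
import HarnessLib

/-!
# Crux `MesoscopicPairOrder` (stmt-HubbardSuperconductivity-7331) — the card's BOX ORDER is FALSE as typed
# (phase-separated witness `vac ⊕ full`), file 2 of 2

Supports item `stmt-HubbardSuperconductivity-7331` (route `FunctionFieldCertificate`, pole-free crux; open physics,
not settled here) by REFUTING the residue of the crux-idea card `window-stationarity-box-transfer` (ideator 3,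
`BoxOrder U n η m R R' r`, and its every-constraint-granted strong form): the claim that every density matrix on
the Fock space of a torus `L ≥ 2R + 2` which is (S) stationary (`0 ≤ Re Tr ρ Qᴴ (H_L Q - Q H_L)` for the
particle-number-preserving `Q`), (T) translation consistent and (D) has MEAN window density within `η` of `n`,
has `R'`-sub-window `d`-wave order `≥ m`, for an unbounded family of scales `R'` with one margin `m > 0`.

Witness (§3): on the torus `L = 2R + 2` take the mixture
`ρ = p |full⟩⟨full| + (1 - p) |vac⟩⟨vac|`, `p = n/2 = (1 - δ)/2`, of the filled lattice `|full⟩ = |univ⟩` and the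
vacuum. Both are alone in their particle-number sectors (`2|Λ|` and `0`), so every `N̂`-commuting `Q` acts on
them as a scalar and `H_L` as an eigenvalue: (S) holds with equality for EVERY such `Q` (§2); both are invariant
under the lattice translations up to a sign: (T) holds for EVERY matrix `A`; the window particle number is
`p · 2R²`: (D) holds EXACTLY; `ρ ⪰ 0`, `Tr ρ = 1`, `[ρ, N̂] = 0`. But its sub-window pair weight is small:
`P_x |vac⟩ = 0`, and `⟨P_x full, P_y full⟩ = 0` unless `x ∈ {y, y ± e₁, y ± e₂}` (the two orbitals a local pair
removes from `|full⟩` sit at `y` and a neighbour; distinct removed pairs give orthogonal basis vectors, §1), so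
`‖B'_u full‖² ≤ 5 · 32 · R'² = 160 R'²` (`‖P_x ψ‖² ≤ 32 ‖ψ‖²`), whence box order forces `m R'² ≤ 160 p < 80` — false
for `R' > 80/m`.

* §1 (file 1, `…BoxOrderRefutationLemmas.lean`) `annihilation_mul_annihilation_mulVec_full_apply_eq_zero`, `localPair_mulVec_full_apply_eq_zero`,
  `star_localPair_full_dotProduct_eq_zero` (orthogonality off the 5-point neighbourhood), `re_dotProduct_le_half`,
  `card_filter_near_le_five`, `re_star_block_full_le` (`Re⟨B'_u full, B'_u full⟩ ≤ 160 R'²`), `localPair_mulVec_vacuum`.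
* §2 (file 1) `isNParticle_vacuum'`, `isNParticle_full`, `eq_smul_vacuum_of_isNParticle_zero`, `eq_smul_full_of_isNParticle_card`,
  `hubbardTorus_commute_totalNumberOp`, `comm_mulVec_eq_zero_of_eigen`, `numberOp_mulVec_full`,
  `expect_relabel_translate_full`, `expect_relabel_translate_vacuum`.
* §3 `boxOrderStrong_at_false` — pointwise: strong box order fails at every `R'` with `m R' > 80`;
  `boxOrderStrong_family_false` — the strong family (all `N̂`-commuting `Q` in (S), all `A, u` in (T),
  `[ρ, N̂] = 0` granted) is false at EVERY `(U, δ, m, η)`; `boxOrder_family_false` — hence so is the card's family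
  (interior-local (S), window-internal (T) only), which grants fewer constraints; `boxOrderFamilyFalse` — registered form.

Reading for the planners. The mean-density constraint (D) admits convex combinations ACROSS particle numbers, and
the two extreme sectors supply exact, translation-invariant, locally inert ground states with no pair
correlations beyond one step; no amount of interior stationarity or translation consistency sees this. What a
ground state actually supplies is a SHARP particle number: the repaired transfer
(`mesoscopicPairOrder_of_sharpBoxOrder`, file `…BoxTransfer.lean`) grants `N̂ ρ = N_L ρ` and is non-vacuous —
but then the admissible states are exactly the translation-invariant mixtures of global `N_L`-particle ground
states, i.e. the repaired box order IS the crux's every-scale body with threshold `L ≥ 2R + 2`. A box-LOCAL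
substitute for "sharp `N`" would have to be window information every sharp-`N` ground state provably carries
(an energy-density cap from a trial state excludes `vac ⊕ full` but not `vac ⊕ (half filling)`; window
particle-number fluctuations of interacting ground states obey no universal bound — phase separation).

Sources: Bratteli–Robinson II §5.2.2 (CAR algebra, occupation basis); Tasaki (2020) §9.2; Pironio–Navascués–Acín,
SIAM J. Optim. 20 (2010) 2157 §2. All folklore; no definition is introduced.
-/

noncomputable section

-- the summit namespace `Summit.HubbardSuperconductivity.HubbardSuperconductivity.…` repeats the problem name by design (D-0017)
set_option linter.dupNamespace false

namespace Summit.HubbardSuperconductivity.HubbardSuperconductivity.Theorems.FunctionFieldCertificate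

open Matrix Finset Filter
open Literature.Probability.LatticeModels Literature.MathematicalPhysics.QuantumLattice
open Summit.HubbardSuperconductivity.HubbardSuperconductivity.Theses.FunctionFieldCertificate
open scoped ComplexOrder

/-! ### §3 The witness and the refutation -/

/-- **Box order in the strong form fails at EVERY large measurement scale.** For `δ ∈ (0, 1/2)`, `η > 0`, any `U`, `m`, collar `r`, scales `0 < R'`, `R' + 2r + 3 ≤ R` with `m R' > 80`: it is NOT the case that on every
torus `L ≥ 2R + 2` every `ρ ⪰ 0` with `Tr ρ = 1`, `[ρ, N̂] = 0`, (S) for all `N̂`-commuting `Q`, (T) for all `A, u` and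
mean window density within `η` of `1 - δ` has `m · #anchors ≤ Σ_{u ∈ anchors} Re Tr ρ B'_uᴴ B'_u / R'⁴`. Witness at
`L = 2R + 2`: `ρ = p|univ⟩⟨univ| + (1-p)|∅⟩⟨∅|`, `p = (1-δ)/2`, whose right-hand side is `≤ #anchors · 160 p / R'²`,
`160 p < 80`. [folklore] -/
theorem boxOrderStrong_at_false (U : ℝ) {δ m η : ℝ} (hδ : δ ∈ Set.Ioo (0:ℝ) (1 / 2)) (hη : 0 < η)
    {R R' r : ℕ} (hR' : 0 < R') (hRR : R' + 2 * r + 3 ≤ R) (hbig : 80 < m * (R' : ℝ)) :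
    ¬ (∀ (L : ℕ) [NeZero L], 2 * R + 2 ≤ L →
      ∀ ρ : Matrix (Finset (Orb (FermionTorus 2 L))) (Finset (Orb (FermionTorus 2 L))) ℂ,
        ρ.PosSemidef → ρ.trace = 1 → Commute ρ totalNumberOp →
        (∀ Q : Matrix (Finset (Orb (FermionTorus 2 L))) (Finset (Orb (FermionTorus 2 L))) ℂ,
          Commute Q totalNumberOp →
            0 ≤ ((ρ * (Qᴴ * (hubbardTorus 2 L 1 U * Q - Q * hubbardTorus 2 L 1 U))).trace).re) →
        (∀ (A : Matrix (Finset (Orb (FermionTorus 2 L))) (Finset (Orb (FermionTorus 2 L))) ℂ)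
          (u : TorusSite 2 L), (ρ * A).trace = (ρ * relabel (Orb.translate u) A).trace) →
        |((ρ * (∑ u : Fin 2 → Fin R, ∑ σ : Fin 2,
            numberOp (FermionTorus.ofTorusSite (fun i => ((u i : ℕ) : ZMod L))) σ)).trace).re /
            (R : ℝ) ^ 2 - (1 - δ)| ≤ η →
        m * (((Finset.univ.filter fun u : TorusSite 2 L =>
            ∀ i, r + 1 ≤ (u i).val ∧ (u i).val + R' + r + 1 < R)).card : ℝ) ≤
          ∑ u ∈ (Finset.univ.filter fun u : TorusSite 2 L =>
              ∀ i, r + 1 ≤ (u i).val ∧ (u i).val + R' + r + 1 < R),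
            ((ρ * ((∑ w : Fin 2 → Fin R', localPair dWaveFormFactor L (u + fun i => ((w i : ℕ) : ZMod L)))ᴴ *
              (∑ w : Fin 2 → Fin R', localPair dWaveFormFactor L (u + fun i => ((w i : ℕ) : ZMod L))))).trace).re /
              (R' : ℝ) ^ 4) := by
  intro hBO
  -- the torus `L = 2R + 2`
  haveI : NeZero (2 * R + 2) := ⟨by omega⟩
  set L : ℕ := 2 * R + 2 with hLdef
  -- occupation-basis terms below are built with the order-derived `DecidableEq` (as the Literature lemmas)
  letI : DecidableEq (Orb (FermionTorus 2 L)) := LinearOrder.toDecidableEq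
  have hR'L : R' ≤ L := by omega
  have hRpos : 0 < R := by omega
  have hRr : (0 : ℝ) < R := Nat.cast_pos.2 hRpos
  have hR'r : (0 : ℝ) < R' := Nat.cast_pos.2 hR'
  -- the witness
  set Ω : Fock (Orb (FermionTorus 2 L)) := Pi.single (Finset.univ : Finset (Orb (FermionTorus 2 L))) (1 : ℂ)
    with hΩ
  set vac : Fock (Orb (FermionTorus 2 L)) := vacuum with hvac
  set p : ℝ := (1 - δ) / 2 with hp
  have hp0 : 0 ≤ p := by rw [hp]; linarith [hδ.2]
  have hp1 : 0 ≤ 1 - p := by rw [hp]; linarith [hδ.1]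
  set ρ : Matrix (Finset (Orb (FermionTorus 2 L))) (Finset (Orb (FermionTorus 2 L))) ℂ :=
    (p : ℂ) • vecMulVec Ω (star Ω) + ((1 - p : ℝ) : ℂ) • vecMulVec vac (star vac) with hρ
  have hΩ1 : star Ω ⬝ᵥ Ω = 1 := by
    rw [hΩ, ← Pi.single_star, star_one, single_dotProduct, one_mul, Pi.single_eq_same]
  have hvac1 : star vac ⬝ᵥ vac = 1 := by
    rw [hvac, vacuum, ← Pi.single_star, star_one, single_dotProduct, one_mul, Pi.single_eq_same]
  have htr : ∀ M : Matrix (Finset (Orb (FermionTorus 2 L))) (Finset (Orb (FermionTorus 2 L))) ℂ,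
      (ρ * M).trace = (p : ℂ) * (star Ω ⬝ᵥ M *ᵥ Ω) + ((1 - p : ℝ) : ℂ) * (star vac ⬝ᵥ M *ᵥ vac) := by
    intro M
    rw [hρ, add_mul, smul_mul_assoc, smul_mul_assoc, trace_add, trace_smul, trace_smul, trace_proj_mul,
      trace_proj_mul, smul_eq_mul, smul_eq_mul]
  -- sector facts
  have hΩN := isNParticle_full (L := L)
  have hvacN := isNParticle_vacuum' (L := L)
  have hHN := hubbardTorus_commute_totalNumberOp (L := L) U
  have hHΩ : hubbardTorus 2 L 1 U *ᵥ Ω = (hubbardTorus 2 L 1 U *ᵥ Ω) Finset.univ • Ω :=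
    eq_smul_full_of_isNParticle_card (isNParticle_mulVec_of_commute_totalNumberOp hΩN hHN)
  have hHvac : hubbardTorus 2 L 1 U *ᵥ vac = (0 : ℂ) • vac := by
    rw [zero_smul, hvac]
    exact hamiltonian_mulVec_vacuum (fermionTorusGraph 2 L) 1 U
  -- the constraints
  have hpsd : ρ.PosSemidef :=
    ((proj_posSemidef Ω).smul (Complex.zero_le_real.2 hp0)).add
      ((proj_posSemidef vac).smul (Complex.zero_le_real.2 hp1))
  have htr1 : ρ.trace = 1 := by
    have h := htr 1
    rw [mul_one, one_mulVec, one_mulVec, hΩ1, hvac1, mul_one, mul_one] at h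
    rw [h]
    push_cast
    ring
  have hcomm : Commute ρ totalNumberOp :=
    ((commute_proj_totalNumberOp hΩN).smul_left _).add_left ((commute_proj_totalNumberOp hvacN).smul_left _)
  have hS : ∀ Q : Matrix (Finset (Orb (FermionTorus 2 L))) (Finset (Orb (FermionTorus 2 L))) ℂ,
      Commute Q totalNumberOp →
        0 ≤ ((ρ * (Qᴴ * (hubbardTorus 2 L 1 U * Q - Q * hubbardTorus 2 L 1 U))).trace).re := by
    intro Q hQ
    have hQΩ : Q *ᵥ Ω = (Q *ᵥ Ω) Finset.univ • Ω :=
      eq_smul_full_of_isNParticle_card (isNParticle_mulVec_of_commute_totalNumberOp hΩN hQ)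
    have hQvac : Q *ᵥ vac = (Q *ᵥ vac) ∅ • vac :=
      eq_smul_vacuum_of_isNParticle_zero (isNParticle_mulVec_of_commute_totalNumberOp hvacN hQ)
    rw [htr, expect_conjTranspose_mul_eq, expect_conjTranspose_mul_eq, comm_mulVec_eq_zero_of_eigen hQΩ hHΩ,
      comm_mulVec_eq_zero_of_eigen hQvac hHvac, dotProduct_zero, dotProduct_zero, mul_zero, mul_zero, add_zero,
      Complex.zero_re]
  have hT : ∀ (A : Matrix (Finset (Orb (FermionTorus 2 L))) (Finset (Orb (FermionTorus 2 L))) ℂ)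
      (u : TorusSite 2 L), (ρ * A).trace = (ρ * relabel (Orb.translate u) A).trace := by
    intro A u
    rw [htr, htr, expect_relabel_translate_full, hvac, expect_relabel_translate_vacuum]
  have hD : |((ρ * (∑ u : Fin 2 → Fin R, ∑ σ : Fin 2,
      numberOp (FermionTorus.ofTorusSite (fun i => ((u i : ℕ) : ZMod L))) σ)).trace).re /
        (R : ℝ) ^ 2 - (1 - δ)| ≤ η := by
    have hΩnum : star Ω ⬝ᵥ (∑ u : Fin 2 → Fin R, ∑ σ : Fin 2,
        numberOp (FermionTorus.ofTorusSite (fun i => ((u i : ℕ) : ZMod L))) σ) *ᵥ Ω = ((2 * R ^ 2 : ℕ) : ℂ) := by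
      rw [Matrix.sum_mulVec, dotProduct_sum]
      have hterm : ∀ u : Fin 2 → Fin R, star Ω ⬝ᵥ (∑ σ : Fin 2,
          numberOp (FermionTorus.ofTorusSite (fun i => ((u i : ℕ) : ZMod L))) σ) *ᵥ Ω = 2 := by
        intro u
        rw [Matrix.sum_mulVec, dotProduct_sum, Fin.sum_univ_two, numberOp_mulVec_full, numberOp_mulVec_full, hΩ1]
        norm_num
      simp_rw [hterm]
      rw [Finset.sum_const, Finset.card_univ, Fintype.card_fun, Fintype.card_fin, Fintype.card_fin, nsmul_eq_mul]
      push_cast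
      ring
    have hvacnum : star vac ⬝ᵥ (∑ u : Fin 2 → Fin R, ∑ σ : Fin 2,
        numberOp (FermionTorus.ofTorusSite (fun i => ((u i : ℕ) : ZMod L))) σ) *ᵥ vac = 0 := by
      rw [Matrix.sum_mulVec, dotProduct_sum]
      refine Finset.sum_eq_zero fun u _ => ?_
      rw [Matrix.sum_mulVec, dotProduct_sum]
      refine Finset.sum_eq_zero fun σ _ => ?_
      rw [hvac, numberOp, ← mulVec_mulVec, annihilation_mulVec_vacuum_holds, mulVec_zero, dotProduct_zero]
    rw [htr, hΩnum, hvacnum, mul_zero, add_zero]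
    have hre : ((p : ℂ) * ((2 * R ^ 2 : ℕ) : ℂ)).re = p * (2 * (R : ℝ) ^ 2) := by
      have : (p : ℂ) * ((2 * R ^ 2 : ℕ) : ℂ) = ((p * (2 * (R : ℝ) ^ 2) : ℝ) : ℂ) := by push_cast; ring
      rw [this, Complex.ofReal_re]
    rw [hre]
    have : p * (2 * (R : ℝ) ^ 2) / (R : ℝ) ^ 2 - (1 - δ) = 0 := by
      rw [hp]
      field_simp
      ring
    rw [this, abs_zero]
    exact hη.le
  -- box order applied to the witness
  have hconcl := hBO L le_rfl ρ hpsd htr1 hcomm hS hT hD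
  set A : Finset (TorusSite 2 L) := Finset.univ.filter fun u : TorusSite 2 L =>
      ∀ i, r + 1 ≤ (u i).val ∧ (u i).val + R' + r + 1 < R with hA
  -- each sub-window term is `≤ 160 p / R'²`
  have hterm : ∀ u : TorusSite 2 L,
      ((ρ * ((∑ w : Fin 2 → Fin R', localPair dWaveFormFactor L (u + fun i => ((w i : ℕ) : ZMod L)))ᴴ *
        (∑ w : Fin 2 → Fin R', localPair dWaveFormFactor L (u + fun i => ((w i : ℕ) : ZMod L))))).trace).re /
          (R' : ℝ) ^ 4 ≤ 160 * p / (R' : ℝ) ^ 2 := by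
    intro u
    have hvac0 : (∑ w : Fin 2 → Fin R', localPair dWaveFormFactor L (u + fun i => ((w i : ℕ) : ZMod L))) *ᵥ vac = 0 := by
      rw [Matrix.sum_mulVec]
      exact Finset.sum_eq_zero fun w _ => by rw [hvac, localPair_mulVec_vacuum]
    rw [htr, expect_conjTranspose_mul_eq, expect_conjTranspose_mul_eq, hvac0, dotProduct_zero, mul_zero, add_zero,
      Complex.re_ofReal_mul]
    have hblock := re_star_block_full_le (L := L) R' hR'L u
    rw [div_le_div_iff₀ (by positivity) (by positivity)]
    have hR4 : (R' : ℝ) ^ 4 = (R' : ℝ) ^ 2 * (R' : ℝ) ^ 2 := by ring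
    rw [hR4]
    have := mul_le_mul_of_nonneg_left hblock hp0
    nlinarith [this, sq_nonneg (R' : ℝ)]
  have hsum : ∑ u ∈ A, ((ρ * ((∑ w : Fin 2 → Fin R', localPair dWaveFormFactor L (u + fun i => ((w i : ℕ) : ZMod L)))ᴴ *
      (∑ w : Fin 2 → Fin R', localPair dWaveFormFactor L (u + fun i => ((w i : ℕ) : ZMod L))))).trace).re /
        (R' : ℝ) ^ 4 ≤ (A.card : ℝ) * (160 * p / (R' : ℝ) ^ 2) := by
    rw [← nsmul_eq_mul, ← Finset.sum_const]
    exact Finset.sum_le_sum fun u _ => hterm u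
  -- the anchor set is nonempty
  have hcard : 0 < A.card := by
    refine Finset.card_pos.2 ⟨fun _ => ((r + 1 : ℕ) : ZMod L), ?_⟩
    simp only [hA, Finset.mem_filter, Finset.mem_univ, true_and]
    intro i
    rw [ZMod.val_natCast_of_lt (by omega : r + 1 < L)]
    omega
  have hcardR : (0 : ℝ) < A.card := Nat.cast_pos.2 hcard
  -- `m ≤ 160 p / R'²`, i.e. `m R'² ≤ 160 p < 80`
  have hm1 : m ≤ 160 * p / (R' : ℝ) ^ 2 := le_of_mul_le_mul_left (by linarith [hconcl, hsum]) hcardR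
  rw [le_div_iff₀ (by positivity)] at hm1
  have hp80 : 160 * p < 80 := by rw [hp]; linarith [hδ.1]
  -- but `m R' > 80`
  have hR'1 : (1 : ℝ) ≤ R' := by exact_mod_cast hR'
  nlinarith [hm1, hp80, hbig, hR'1]

/-- **The strong box-order family is FALSE at every `(U, δ, m, η)`.** There are no `U > 0`, `δ ∈ (0,1/2)`,
`m, η > 0` for which, for every `R₀`, some scales `R' ≥ R₀`, `0 < R'`, `r`, `R ≥ R' + 2r + 3` carry box order in the
strong form — every `ρ ⪰ 0` with `Tr ρ = 1`, `[ρ, N̂] = 0`, (S) for ALL `N̂`-commuting `Q`, (T) for ALL `A, u`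
and MEAN window density within `η` of `1 - δ` on any torus `L ≥ 2R + 2` having
`m · #anchors ≤ Σ_{u ∈ anchors} Re Tr ρ B'_uᴴ B'_u / R'⁴`. Witness at `L = 2R + 2`:
`ρ = p|univ⟩⟨univ| + (1-p)|∅⟩⟨∅|`, `p = (1-δ)/2`, for which the right-hand side is `≤ #anchors · 160 p / R'²`
while `R' > 80/m`. [folklore] -/
theorem boxOrderStrong_family_false :
    ¬ (∃ U : ℝ, 0 < U ∧ ∃ δ ∈ Set.Ioo (0:ℝ) (1 / 2), ∃ m η : ℝ, 0 < m ∧ 0 < η ∧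
      ∀ R₀ : ℕ, ∃ R R' r : ℕ, R₀ ≤ R' ∧ 0 < R' ∧ R' + 2 * r + 3 ≤ R ∧
        ∀ (L : ℕ) [NeZero L], 2 * R + 2 ≤ L →
          ∀ ρ : Matrix (Finset (Orb (FermionTorus 2 L))) (Finset (Orb (FermionTorus 2 L))) ℂ,
            ρ.PosSemidef → ρ.trace = 1 → Commute ρ totalNumberOp →
            (∀ Q : Matrix (Finset (Orb (FermionTorus 2 L))) (Finset (Orb (FermionTorus 2 L))) ℂ,
              Commute Q totalNumberOp →
                0 ≤ ((ρ * (Qᴴ * (hubbardTorus 2 L 1 U * Q - Q * hubbardTorus 2 L 1 U))).trace).re) →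
            (∀ (A : Matrix (Finset (Orb (FermionTorus 2 L))) (Finset (Orb (FermionTorus 2 L))) ℂ)
              (u : TorusSite 2 L), (ρ * A).trace = (ρ * relabel (Orb.translate u) A).trace) →
            |((ρ * (∑ u : Fin 2 → Fin R, ∑ σ : Fin 2,
                numberOp (FermionTorus.ofTorusSite (fun i => ((u i : ℕ) : ZMod L))) σ)).trace).re /
                (R : ℝ) ^ 2 - (1 - δ)| ≤ η →
            m * (((Finset.univ.filter fun u : TorusSite 2 L =>
                ∀ i, r + 1 ≤ (u i).val ∧ (u i).val + R' + r + 1 < R)).card : ℝ) ≤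
              ∑ u ∈ (Finset.univ.filter fun u : TorusSite 2 L =>
                  ∀ i, r + 1 ≤ (u i).val ∧ (u i).val + R' + r + 1 < R),
                ((ρ * ((∑ w : Fin 2 → Fin R', localPair dWaveFormFactor L (u + fun i => ((w i : ℕ) : ZMod L)))ᴴ *
                  (∑ w : Fin 2 → Fin R', localPair dWaveFormFactor L (u + fun i => ((w i : ℕ) : ZMod L))))).trace).re /
                  (R' : ℝ) ^ 4) := by
  rintro ⟨U, _hU, δ, hδ, m, η, hm, hη, hfam⟩
  obtain ⟨R, R', r, hR₀, hR', hRR, hBO⟩ := hfam (⌈80 / m⌉₊ + 1)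
  have hR'big : 80 / m < (R' : ℝ) := by
    have h1 : (80 / m : ℝ) ≤ ⌈80 / m⌉₊ := Nat.le_ceil _
    have h2 : ((⌈80 / m⌉₊ + 1 : ℕ) : ℝ) ≤ R' := by exact_mod_cast hR₀
    push_cast at h2
    linarith
  rw [div_lt_iff₀ hm] at hR'big
  exact boxOrderStrong_at_false U hδ hη hR' hRR (by linarith) (fun L _ hL => hBO L hL)

/-- **The card's box-order family is FALSE** (card window-stationarity-box-transfer, `BoxOrder`/`BoxOrderGivesCrux`
with its abbreviations unfolded: (S) only for the `N̂`-commuting `Q` in the *-algebra of the modes of the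
`r`-interior, (T) only for observables supported in the window together with their translate): it grants FEWER
constraints than the strong form, so it implies the strong family, which is false
(`boxOrderStrong_family_false`). [folklore] -/
theorem boxOrder_family_false :
    ¬ (∃ U : ℝ, 0 < U ∧ ∃ δ ∈ Set.Ioo (0:ℝ) (1 / 2), ∃ m η : ℝ, 0 < m ∧ 0 < η ∧
      ∀ R₀ : ℕ, ∃ R R' r : ℕ, R₀ ≤ R' ∧ 0 < R' ∧ R' + 2 * r + 3 ≤ R ∧
        ∀ (L : ℕ) [NeZero L], 2 * R + 2 ≤ L →
          ∀ ρ : Matrix (Finset (Orb (FermionTorus 2 L))) (Finset (Orb (FermionTorus 2 L))) ℂ,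
            ρ.PosSemidef → ρ.trace = 1 →
            (∀ Q ∈ StarAlgebra.adjoin ℂ
                {a : Matrix (Finset (Orb (FermionTorus 2 L))) (Finset (Orb (FermionTorus 2 L))) ℂ |
                  ∃ x ∈ (Finset.univ.filter fun x : TorusSite 2 L => ∀ i, r ≤ (x i).val ∧ (x i).val + r < R),
                    ∃ σ : Fin 2, a = annihilation (orb (FermionTorus.ofTorusSite x) σ)},
              Commute Q totalNumberOp →
                0 ≤ ((ρ * (Qᴴ * (hubbardTorus 2 L 1 U * Q - Q * hubbardTorus 2 L 1 U))).trace).re) →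
            (∀ (S : Finset (TorusSite 2 L)) (u : TorusSite 2 L),
              S ⊆ (Finset.univ.filter fun x : TorusSite 2 L => ∀ i, (x i).val < R) →
              S.image (· + u) ⊆ (Finset.univ.filter fun x : TorusSite 2 L => ∀ i, (x i).val < R) →
              ∀ A ∈ StarAlgebra.adjoin ℂ
                {a : Matrix (Finset (Orb (FermionTorus 2 L))) (Finset (Orb (FermionTorus 2 L))) ℂ |
                  ∃ x ∈ S, ∃ σ : Fin 2, a = annihilation (orb (FermionTorus.ofTorusSite x) σ)},
                (ρ * A).trace = (ρ * relabel (Orb.translate u) A).trace) →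
            |((ρ * (∑ u : Fin 2 → Fin R, ∑ σ : Fin 2,
                numberOp (FermionTorus.ofTorusSite (fun i => ((u i : ℕ) : ZMod L))) σ)).trace).re /
                (R : ℝ) ^ 2 - (1 - δ)| ≤ η →
            m * (((Finset.univ.filter fun u : TorusSite 2 L =>
                ∀ i, r + 1 ≤ (u i).val ∧ (u i).val + R' + r + 1 < R)).card : ℝ) ≤
              ∑ u ∈ (Finset.univ.filter fun u : TorusSite 2 L =>
                  ∀ i, r + 1 ≤ (u i).val ∧ (u i).val + R' + r + 1 < R),
                ((ρ * ((∑ w : Fin 2 → Fin R', localPair dWaveFormFactor L (u + fun i => ((w i : ℕ) : ZMod L)))ᴴ *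
                  (∑ w : Fin 2 → Fin R', localPair dWaveFormFactor L (u + fun i => ((w i : ℕ) : ZMod L))))).trace).re /
                  (R' : ℝ) ^ 4) := by
  rintro ⟨U, hU, δ, hδ, m, η, hm, hη, hbox⟩
  refine boxOrderStrong_family_false ⟨U, hU, δ, hδ, m, η, hm, hη, fun R₀ => ?_⟩
  obtain ⟨R, R', r, hR₀, hR', hRR, hBO⟩ := hbox R₀
  refine ⟨R, R', r, hR₀, hR', hRR, fun L _ hL ρ hpsd htr _hcomm hS hT hD => ?_⟩
  exact hBO L hL ρ hpsd htr (fun Q _ hQ => hS Q hQ) (fun S u _ _ A _ => hT A u) hD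

/-- **Registered form of the refutation** (sub-goal `boxOrderFamilyFalse` of crux stmt-HubbardSuperconductivity-7331,
line `Sketch`; verbatim `boxOrder_family_false`): the card's box-order family is false. [folklore] -/
theorem boxOrderFamilyFalse : ¬ (∃ U : ℝ, 0 < U ∧ ∃ δ ∈ Set.Ioo (0:ℝ) (1 / 2), ∃ m η : ℝ, 0 < m ∧ 0 < η ∧ ∀ R₀ : ℕ, ∃ R R' r : ℕ, R₀ ≤ R' ∧ 0 < R' ∧ R' + 2 * r + 3 ≤ R ∧ ∀ (L : ℕ) [NeZero L], 2 * R + 2 ≤ L → ∀ ρ : Matrix (Finset (Orb (FermionTorus 2 L))) (Finset (Orb (FermionTorus 2 L))) ℂ, ρ.PosSemidef → ρ.trace = 1 → (∀ Q ∈ StarAlgebra.adjoin ℂ {a : Matrix (Finset (Orb (FermionTorus 2 L))) (Finset (Orb (FermionTorus 2 L))) ℂ | ∃ x ∈ (Finset.univ.filter fun x : TorusSite 2 L => ∀ i, r ≤ (x i).val ∧ (x i).val + r < R), ∃ σ : Fin 2, a = annihilation (orb (FermionTorus.ofTorusSite x) σ)}, Commute Q totalNumberOp → 0 ≤ ((ρ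 * (Qᴴ * (hubbardTorus 2 L 1 U * Q - Q * hubbardTorus 2 L 1 U))).trace).re) → (∀ (S : Finset (TorusSite 2 L)) (u : TorusSite 2 L), S ⊆ (Finset.univ.filter fun x : TorusSite 2 L => ∀ i, (x i).val < R) → S.image (· + u) ⊆ (Finset.univ.filter fun x : TorusSite 2 L => ∀ i, (x i).val < R) → ∀ A ∈ StarAlgebra.adjoin ℂ {a : Matrix (Finset (Orb (FermionTorus 2 L))) (Finset (Orb (FermionTorus 2 L))) ℂ | ∃ x ∈ S, ∃ σ : Fin 2, a = annihilation (orb (FermionTorus.ofTorusSite x) σ)}, (ρ * A).trace = (ρ * relabel (Orb.translate u) A).trace) → |((ρ * (∑ u : Fin 2 → Fin R, ∑ σ : Fin 2, numberOp (FermionTorus.ofTorusSite (fun i => ((u i : ℕ) : ZMod L))) σ)).trace).re / (R : ℝ) ^ 2 - (1 - δ)| ≤ η → m * (((Finset.univ.filter fun u : TorusSite 2 L => ∀ i, r + 1 ≤ (u i).val ∧ (u i).val + R' + r + 1 < R)).card : ℝ) ≤ ∑ u ∈ (Finset.univ.filter fun u : TorusSite 2 L => ∀ i, r + 1 ≤ (u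 i).val ∧ (u i).val + R' + r + 1 < R), ((ρ * ((∑ w : Fin 2 → Fin R', localPair dWaveFormFactor L (u + fun i => ((w i : ℕ) : ZMod L)))ᴴ * (∑ w : Fin 2 → Fin R', localPair dWaveFormFactor L (u + fun i => ((w i : ℕ) : ZMod L))))).trace).re / (R' : ℝ) ^ 4) :=
  boxOrder_family_false

end Summit.HubbardSuperconductivity.HubbardSuperconductivity.Theorems.FunctionFieldCertificate
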